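import Literature.NumberTheory.EllipticCurves.DeligneSerreWeightOneOfThm61
import Literature.NumberTheory.EllipticCurves.EichlerShimuraPeriodsGamma1RealSpanProofs
import Literature.NumberTheory.EllipticCurves.DeligneSerreProp27RealLatticeProofs
import Literature.NumberTheory.EllipticCurves.DeligneSerreProp27WeightReductionProofs
import Literature.NumberTheory.LFunctions.ChebotarevDensityProofs
import HarnessLib

/-!
# Deligne–Serre 1974, Thm. 4.1 (existence): Chebotarev discharged; reduction to Thm. 6.1/6.7 and
# the rank half of the Eichler–Shimura isomorphism for `Γ₁(M)`

A *proofs* file (theorems only; no definition, no named fact, nothing restated; D-0026) continuing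
`Literature.NumberTheory.EllipticCurves.DeligneSerreWeightOneOfThm61` and
`Literature.NumberTheory.EllipticCurves.DeligneSerreWeightOneAssembly`, which reduce the named fact
`Literature.NumberTheory.EllipticCurves.ModularForms.DeligneSerre1974.thm41_exists`
(`NewformGaloisRepProofs`; Deligne–Serre, *Formes modulaires de poids 1*, Thm. 4.1, pp. 513–514,
first assertion with §3 (a): a newform `f ∈ S_1(Γ₁(N))` has an attached continuous
`ρ : Gal(ℚ̄/ℚ) → GL₂(ℂ)` with finite image, unramified outside `N`, `Tr ρ(F_p) = a_p`,
`det ρ(F_p) = ε(p)`) to three inputs: (A) Thm. 6.7 in weight one (`thm67_weightOne`; behind it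
Deligne's Thm. 6.1 as printed, the hypothesis `h61` of `thm41_exists_of_thm61`), (B) Chebotarev's
density theorem over `ℚ` (`Literature.NumberTheory.LFunctions.Chebotarev.dirichletDensity_eq`),
(C) the spanning statement (2.7.2) `DeligneSerre1974_span_integralLattice1 M k` for all levels `M`
and weights `k ≥ 2`.  Two of these have since moved in the tree, and this file records the effect
on `thm41_exists`:

* **(B) is now a theorem**: `LFunctions.Chebotarev.dirichletDensity_eq_holds`
  (`ChebotarevDensityProofs`: Weber's ray-class estimate ⇒ regularity of ray-class `L`-series at
  `s = 1` ⇒ the cyclotomic density theorem ⇒ Chebotarev over `ℚ` by the 1926 crossing argument).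
* **(C) is reduced to the rank half of Eichler–Shimura in large weights**: level by level, (2.7.2)
  in all weights follows from (2.7.2) in the weights `k ≥ K₀` for any threshold
  (`DeligneSerre1974_span_integralLattice1.of_forall_le`, division by `E₄`, `E₆`,
  `DeligneSerreProp27WeightReductionProofs`); in a weight `n + 2` it follows from a full
  Hecke-stable real lattice in `S_{n+2}(Γ₁(M))^∨` (`HeckeStableRealLattice M (n + 2)`, Shimura 1971,
  (3.5.20), via his Thm. 3.48 (2), 3.51, 3.52:
  `DeligneSerre1974_span_integralLattice1_of_heckeStableRealLattice`,
  `DeligneSerreProp27RealLatticeProofs`); and for `n ≥ 5` such a lattice is the Eichler–Shimura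
  period lattice `periodLatticeK1 n` as soon as it is the `ℤ`-span of `2 dim_ℂ S_{n+2}(Γ₁(M))`
  functionals (`heckeStableRealLatticeOfGenerators`, `EichlerShimuraPeriodsGamma1RealSpanProofs`,
  whose `periodLatticeK1_span_real_eq_top` proves the spanning half — injectivity of the real
  Eichler–Shimura map — for all levels and all weights `≥ 7`).

Results (the hypothesis shapes are those of `prop55_of_periodLatticeK1_eq_span`,
`DeligneSerreRankinProp55Proofs`, so that one rank theorem discharges everything at once):

* `thm41_exists_of_thm67_of_span_of_le` — Thm. 4.1 (existence) from Thm. 6.7 in weight one and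
  (2.7.2) for every level in all sufficiently large weights (threshold depending on the level);
* `thm41_exists_of_thm67_of_periodLatticeK1_eq_span` — from Thm. 6.7 in weight one and the rank
  half of Eichler–Shimura for `Γ₁(M)`, every `M`, all large `n`;
* `thm67_weightOne_of_thm61_of_periodLatticeK1_eq_span` — Thm. 6.7 in weight one at level `N` from
  Thm. 6.1 (as printed) and the rank half at the level `N` alone;
* `thm41_exists_of_thm61_of_span_of_le`, **`thm41_exists_of_thm61_of_periodLatticeK1_eq_span`** —
  Thm. 4.1 (existence) from exactly two inputs: Deligne's Thm. 6.1 (`λ`-adic representations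
  attached to eigenforms of weight `≥ 2` at every finite place, op. cit. p. 521) and the rank half
  of the Eichler–Shimura isomorphism for `Γ₁(M)` in large weights (Shimura 1971, Thm. 8.4 with
  Prop. 8.6: `rank_ℤ = 2 dim_ℂ S_{n+2}(Γ₁(M))`).

So the trust base of `thm41_exists` is now {Thm. 6.1, Eichler–Shimura rank count}; its discharge
`thm41_exists_holds` is the last theorem here applied to proofs of those two statements, once the
tree has them.

## References

* P. Deligne, J.-P. Serre, *Formes modulaires de poids 1*, Ann. Sci. ÉNS (4) 7 (1974), 507–530:
  Thm. 4.1 (pp. 513–514), Prop. 2.7 and Rem. 2.8 (p. 512), Thm. 6.1 and Thm. 6.7 (p. 521),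
  6.8–6.13 (pp. 521–523), Lemme 8.3 and §8.2–8.6 (pp. 525–527). [DeligneSerreASENS1974]
* G. Shimura, *Introduction to the arithmetic theory of automorphic functions*, Publ. Math. Soc.
  Japan 11 (1971), (3.5.20), Thm. 3.48, Thm. 3.52 (pp. 83–86), Thm. 8.4 and Prop. 8.6 (§8.4).
* J. Neukirch, *Algebraic Number Theory*, Grundlehren 322 (1999), VII Thm. (13.4).
-/

noncomputable section

open scoped MatrixGroups ModularForm NumberField Polynomial

open CongruenceSubgroup IsDedekindDomain Polynomial Rat.HeightOneSpectrum

namespace Literature.NumberTheory.EllipticCurves.ModularForms.DeligneSerre1974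

variable {N : ℕ} [NeZero N]

/-! ### (2.7.2) level by level from large weights, and from the rank hypothesis -/

/-- (2.7.2) at a level `M` in every weight from (2.7.2) at that level in all weights `k ≥ K₀`
(`DeligneSerre1974_span_integralLattice1.of_forall_le`, Deligne–Serre Rem. 2.8 with `E₄`, `E₆`),
packaged for a level-dependent threshold. [cite: DeligneSerreASENS1974, Prop. 2.7 (2.7.2) and Rem. 2.8] -/
theorem span_integralLattice1_of_exists_forall_le
    (hL : ∀ (M : ℕ) [NeZero M], ∃ K₀ : ℤ, ∀ k : ℤ, K₀ ≤ k →
      DeligneSerre1974_span_integralLattice1 M k)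
    (M : ℕ) [NeZero M] (k : ℤ) : DeligneSerre1974_span_integralLattice1 M k := by
  obtain ⟨K₀, hK₀⟩ := hL M
  exact DeligneSerre1974_span_integralLattice1.of_forall_le hK₀ k

/-- (2.7.2) at a level `M` in all weights `n + 2`, `n ≥ max n₀ 5`, from the rank half of
Eichler–Shimura at that level: for `n ≥ 5` the period lattice `periodLatticeK1 n` spans
`S_{n+2}(Γ₁(M))^∨` over `ℝ` (`periodLatticeK1_span_real_eq_top`), so if it is the `ℤ`-span of
`2 dim_ℂ S_{n+2}(Γ₁(M))` functionals it is a full Hecke-stable real lattice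
(`heckeStableRealLatticeOfGenerators`, Shimura 1971, (3.5.20)), which gives (2.7.2) in weight
`n + 2` (`DeligneSerre1974_span_integralLattice1_of_heckeStableRealLattice`, Shimura Thm. 3.52);
then every weight by `span_integralLattice1_of_exists_forall_le`.
[cite: Shimura1971, (3.5.20), Thm. 3.52 and Thm. 8.4] -/
theorem span_integralLattice1_of_periodLatticeK1_eq_span
    (H : ∀ (M : ℕ) [NeZero M], ∃ n₀ : ℕ, ∀ n : ℕ, n₀ ≤ n →
      ∃ g : Fin (2 * Module.finrank ℂ (CuspForm (Gamma1 M) (n + 2))) →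
          Module.Dual ℂ (CuspForm (Gamma1 M) (n + 2)),
        (periodLatticeK1 (N := M) n : Set (Module.Dual ℂ (CuspForm (Gamma1 M) (n + 2)))) =
          Submodule.span ℤ (Set.range g))
    (M : ℕ) [NeZero M] (k : ℤ) : DeligneSerre1974_span_integralLattice1 M k := by
  refine span_integralLattice1_of_exists_forall_le (fun M _ ↦ ?_) M k
  obtain ⟨n₀, hn₀⟩ := H M
  refine ⟨(max n₀ 5 : ℕ) + 2, fun k hk ↦ ?_⟩
  obtain ⟨n, rfl⟩ : ∃ n : ℕ, k = (n : ℤ) + 2 := ⟨(k - 2).toNat, by omega⟩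
  have hn : max n₀ 5 ≤ n := by omega
  obtain ⟨g, hg⟩ := hn₀ n ((le_max_left n₀ 5).trans hn)
  exact DeligneSerre1974_span_integralLattice1_of_heckeStableRealLattice (by omega)
    (heckeStableRealLatticeOfGenerators ((le_max_right n₀ 5).trans hn) g hg)

/-! ### Thm. 4.1 (existence) from Thm. 6.7 in weight one, Chebotarev discharged -/

/-- **Deligne–Serre 1974, Thm. 4.1 (existence, with §3 (a)) from Thm. 6.7 in weight one and
(2.7.2) in large weights.**  For every newform `f ∈ S_1(Γ₁(N))` there is a continuous
`ρ : Gal(ℚ̄/ℚ) → GL₂(ℂ)` with finite image attached to `f` away from `N` (`thm41_exists`),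
granted (A) op. cit. Thm. 6.7 in weight one (`thm67_weightOne`) and (C) for every level `M ≥ 1`
the spanning statement (2.7.2) (`DeligneSerre1974_span_integralLattice1 M k`) in all weights
`k ≥ K₀(M)`.  The Chebotarev density theorem over `ℚ` used in Lemme 8.3 is the tree's theorem
`LFunctions.Chebotarev.dirichletDensity_eq_holds`; the rest of §8.2–8.6 (Prop. 5.1, 5.5, 7.2,
2.7, Lemme 3.2, the lift of 8.6) is `thm41_exists_of_leaves`, and the passage from large weights
to every weight (weight one included) is Rem. 2.8 (`DeligneSerre1974_span_integralLattice1.of_forall_le`).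
[cite: DeligneSerreASENS1974, Thm. 4.1, Rem. 2.8, Thm. 6.7 and §8.2–8.6] -/
theorem thm41_exists_of_thm67_of_span_of_le (h67 : thm67_weightOne (N := N))
    (hL : ∀ (M : ℕ) [NeZero M], ∃ K₀ : ℤ, ∀ k : ℤ, K₀ ≤ k →
      DeligneSerre1974_span_integralLattice1 M k) :
    thm41_exists (N := N) :=
  thm41_exists_of_leaves h67 LFunctions.Chebotarev.dirichletDensity_eq_holds
    fun M _ k ↦ span_integralLattice1_of_exists_forall_le hL M k

/-- **Deligne–Serre 1974, Thm. 4.1 (existence) from Thm. 6.7 in weight one and the rank half of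
the Eichler–Shimura isomorphism for `Γ₁(M)`.**  Granted (A) Thm. 6.7 in weight one
(`thm67_weightOne`) and, for every level `M ≥ 1` and all `n ≥ n₀(M)`, that the Eichler–Shimura
period lattice of `S_{n+2}(Γ₁(M))` is the `ℤ`-span of `2 dim_ℂ S_{n+2}(Γ₁(M))` functionals
(Shimura 1971, Thm. 8.4 with Prop. 8.6), `thm41_exists` holds: the spanning half of Shimura's
(3.5.20) is `periodLatticeK1_span_real_eq_top`, (2.7.2) follows in every weight
(`span_integralLattice1_of_periodLatticeK1_eq_span`), Chebotarev is `dirichletDensity_eq_holds`.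
[cite: DeligneSerreASENS1974, Thm. 4.1, Rem. 2.8, Thm. 6.7 and §8.2–8.6] -/
theorem thm41_exists_of_thm67_of_periodLatticeK1_eq_span (h67 : thm67_weightOne (N := N))
    (H : ∀ (M : ℕ) [NeZero M], ∃ n₀ : ℕ, ∀ n : ℕ, n₀ ≤ n →
      ∃ g : Fin (2 * Module.finrank ℂ (CuspForm (Gamma1 M) (n + 2))) →
          Module.Dual ℂ (CuspForm (Gamma1 M) (n + 2)),
        (periodLatticeK1 (N := M) n : Set (Module.Dual ℂ (CuspForm (Gamma1 M) (n + 2)))) =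
          Submodule.span ℤ (Set.range g)) :
    thm41_exists (N := N) :=
  thm41_exists_of_leaves h67 LFunctions.Chebotarev.dirichletDensity_eq_holds
    fun M _ k ↦ span_integralLattice1_of_periodLatticeK1_eq_span H M k

/-! ### Thm. 6.7 in weight one and Thm. 4.1 (existence) from Deligne's Thm. 6.1 -/

/-- **Deligne–Serre 1974, Thm. 6.7 in weight one from Thm. 6.1 and (2.7.2) at level `N` in large
weights** (`thm67_weightOne_of_thm61_of_span` with Chebotarev — used in (6.12.1) — discharged by
`LFunctions.Chebotarev.dirichletDensity_eq_holds`, and (2.7.2) in weight one from the weights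
`≥ K₀` by Rem. 2.8). [cite: DeligneSerreASENS1974, Thm. 6.7 with Thm. 6.1, 6.8–6.13 and Rem. 2.8] -/
theorem thm67_weightOne_of_thm61_of_span_of_le
    (h61 : ∀ (M : ℕ) [NeZero M] (k : ℤ), 2 ≤ k →
      ∀ (g : CuspForm (Gamma1 M) k) (χ : DirichletCharacter ℂ M),
        g ∈ nebentypusSubspace M k χ → g ≠ 0 →
      ∀ (K : Type) [Field K] [NumberField K] (e : K →+* ℂ) (a : ℕ → K) (c : ZMod M → K),
        (∀ d, e (c d) = χ d) →
        (∀ (p : ℕ) (hp : p.Prime), ¬ p ∣ M →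
          (haveI : NeZero p := ⟨hp.ne_zero⟩; heckeT (Gamma1 M) k p g) = e (a p) • g) →
      ∀ v : HeightOneSpectrum (𝓞 K),
        ∃ ρ : GaloisRepresentations.FramedGaloisRep ℚ (v.adicCompletion K) 2,
          ρ.toGaloisRep.IsSemisimple ∧
          ∀ w : HeightOneSpectrum (𝓞 ℚ), ¬ ((primesEquiv w : Nat.Primes) : ℕ) ∣ M →
            (((primesEquiv w : Nat.Primes) : ℕ) : 𝓞 K) ∉ v.asIdeal →
            ρ.IsUnramifiedAt w ∧
            ρ.HasFrobCharpolyAt w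
              ((X ^ 2 - C (a ((primesEquiv w : Nat.Primes) : ℕ)) * X +
                C (c ((primesEquiv w : Nat.Primes) : ℕ) *
                  (((primesEquiv w : Nat.Primes) : ℕ) : K) ^ (k - 1))).map
                (algebraMap K (v.adicCompletion K))))
    {K₀ : ℤ} (hL : ∀ k : ℤ, K₀ ≤ k → DeligneSerre1974_span_integralLattice1 N k) :
    thm67_weightOne (N := N) :=
  thm67_weightOne_of_thm61_of_span h61 LFunctions.Chebotarev.dirichletDensity_eq_holds
    (DeligneSerre1974_span_integralLattice1.of_forall_le hL 1)

/-- **Deligne–Serre 1974, Thm. 6.7 in weight one from Thm. 6.1 and the rank half of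
Eichler–Shimura at level `N`**: if for all `n ≥ n₀` the period lattice of `S_{n+2}(Γ₁(N))` is the
`ℤ`-span of `2 dim_ℂ S_{n+2}(Γ₁(N))` functionals (Shimura 1971, Thm. 8.4 with Prop. 8.6), then
(2.7.2) holds at level `N` in every weight (`span_integralLattice1_of_periodLatticeK1_eq_span`,
applied at the one level `N`) and `thm67_weightOne_of_thm61_of_span_of_le` applies.
[cite: DeligneSerreASENS1974, Thm. 6.7 with Thm. 6.1, 6.8–6.13 and Rem. 2.8] -/
theorem thm67_weightOne_of_thm61_of_periodLatticeK1_eq_span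
    (h61 : ∀ (M : ℕ) [NeZero M] (k : ℤ), 2 ≤ k →
      ∀ (g : CuspForm (Gamma1 M) k) (χ : DirichletCharacter ℂ M),
        g ∈ nebentypusSubspace M k χ → g ≠ 0 →
      ∀ (K : Type) [Field K] [NumberField K] (e : K →+* ℂ) (a : ℕ → K) (c : ZMod M → K),
        (∀ d, e (c d) = χ d) →
        (∀ (p : ℕ) (hp : p.Prime), ¬ p ∣ M →
          (haveI : NeZero p := ⟨hp.ne_zero⟩; heckeT (Gamma1 M) k p g) = e (a p) • g) →
      ∀ v : HeightOneSpectrum (𝓞 K),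
        ∃ ρ : GaloisRepresentations.FramedGaloisRep ℚ (v.adicCompletion K) 2,
          ρ.toGaloisRep.IsSemisimple ∧
          ∀ w : HeightOneSpectrum (𝓞 ℚ), ¬ ((primesEquiv w : Nat.Primes) : ℕ) ∣ M →
            (((primesEquiv w : Nat.Primes) : ℕ) : 𝓞 K) ∉ v.asIdeal →
            ρ.IsUnramifiedAt w ∧
            ρ.HasFrobCharpolyAt w
              ((X ^ 2 - C (a ((primesEquiv w : Nat.Primes) : ℕ)) * X +
                C (c ((primesEquiv w : Nat.Primes) : ℕ) *
                  (((primesEquiv w : Nat.Primes) : ℕ) : K) ^ (k - 1))).map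
                (algebraMap K (v.adicCompletion K))))
    {n₀ : ℕ} (H : ∀ n : ℕ, n₀ ≤ n →
      ∃ g : Fin (2 * Module.finrank ℂ (CuspForm (Gamma1 N) (n + 2))) →
          Module.Dual ℂ (CuspForm (Gamma1 N) (n + 2)),
        (periodLatticeK1 (N := N) n : Set (Module.Dual ℂ (CuspForm (Gamma1 N) (n + 2)))) =
          Submodule.span ℤ (Set.range g)) :
    thm67_weightOne (N := N) := by
  refine thm67_weightOne_of_thm61_of_span h61 LFunctions.Chebotarev.dirichletDensity_eq_holds ?_
  refine DeligneSerre1974_span_integralLattice1.of_forall_le (K₀ := (max n₀ 5 : ℕ) + 2)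
    (fun k hk ↦ ?_) 1
  obtain ⟨n, rfl⟩ : ∃ n : ℕ, k = (n : ℤ) + 2 := ⟨(k - 2).toNat, by omega⟩
  have hn : max n₀ 5 ≤ n := by omega
  obtain ⟨g, hg⟩ := H n ((le_max_left n₀ 5).trans hn)
  exact DeligneSerre1974_span_integralLattice1_of_heckeStableRealLattice (by omega)
    (heckeStableRealLatticeOfGenerators ((le_max_right n₀ 5).trans hn) g hg)

/-- **Deligne–Serre 1974, Thm. 4.1 (existence, with §3 (a)) from Deligne's Thm. 6.1 and (2.7.2)
in large weights.**  `thm41_exists_of_thm61` with its Chebotarev hypothesis (Lemme 8.3, (6.12.1))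
discharged by `LFunctions.Chebotarev.dirichletDensity_eq_holds` and (2.7.2) assumed, for every
level `M`, only in the weights `k ≥ K₀(M)` (Rem. 2.8: `DeligneSerre1974_span_integralLattice1.of_forall_le`).
[cite: DeligneSerreASENS1974, Thm. 4.1; proof §8 with Thm. 6.1, Thm. 6.7, Prop. 2.7, Rem. 2.8] -/
theorem thm41_exists_of_thm61_of_span_of_le
    (h61 : ∀ (M : ℕ) [NeZero M] (k : ℤ), 2 ≤ k →
      ∀ (g : CuspForm (Gamma1 M) k) (χ : DirichletCharacter ℂ M),
        g ∈ nebentypusSubspace M k χ → g ≠ 0 →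
      ∀ (K : Type) [Field K] [NumberField K] (e : K →+* ℂ) (a : ℕ → K) (c : ZMod M → K),
        (∀ d, e (c d) = χ d) →
        (∀ (p : ℕ) (hp : p.Prime), ¬ p ∣ M →
          (haveI : NeZero p := ⟨hp.ne_zero⟩; heckeT (Gamma1 M) k p g) = e (a p) • g) →
      ∀ v : HeightOneSpectrum (𝓞 K),
        ∃ ρ : GaloisRepresentations.FramedGaloisRep ℚ (v.adicCompletion K) 2,
          ρ.toGaloisRep.IsSemisimple ∧
          ∀ w : HeightOneSpectrum (𝓞 ℚ), ¬ ((primesEquiv w : Nat.Primes) : ℕ) ∣ M →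
            (((primesEquiv w : Nat.Primes) : ℕ) : 𝓞 K) ∉ v.asIdeal →
            ρ.IsUnramifiedAt w ∧
            ρ.HasFrobCharpolyAt w
              ((X ^ 2 - C (a ((primesEquiv w : Nat.Primes) : ℕ)) * X +
                C (c ((primesEquiv w : Nat.Primes) : ℕ) *
                  (((primesEquiv w : Nat.Primes) : ℕ) : K) ^ (k - 1))).map
                (algebraMap K (v.adicCompletion K))))
    (hL : ∀ (M : ℕ) [NeZero M], ∃ K₀ : ℤ, ∀ k : ℤ, K₀ ≤ k →
      DeligneSerre1974_span_integralLattice1 M k) :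
    thm41_exists (N := N) := by
  obtain ⟨K₀, hK₀⟩ := hL N
  exact thm41_exists_of_thm67_of_span_of_le (thm67_weightOne_of_thm61_of_span_of_le h61 hK₀) hL

/-- **Deligne–Serre 1974, Thm. 4.1 (existence, with §3 (a)) from exactly two inputs: Deligne's
Thm. 6.1 and the rank half of the Eichler–Shimura isomorphism for `Γ₁(M)`.**  For every newform
`f ∈ S_1(Γ₁(N))` there is a continuous `ρ : Gal(ℚ̄/ℚ) → GL₂(ℂ)` with finite image attached to `f`
away from `N` (`thm41_exists`), granted: (A′) Deligne's `λ`-adic representations attached to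
eigenforms of type `(k, ε)`, `k ≥ 2`, at **every** finite place `λ` (op. cit. Thm. 6.1 as printed,
`h61`); (C′) for every level `M ≥ 1` and all `n ≥ n₀(M)`, the Eichler–Shimura period lattice of
`S_{n+2}(Γ₁(M))` is the `ℤ`-span of `2 dim_ℂ S_{n+2}(Γ₁(M))` functionals (Shimura 1971, Thm. 8.4
with Prop. 8.6 — the rank count `dim_ℝ H¹_P = 2 dim_ℂ S_k`; its spanning half is the tree's
`periodLatticeK1_span_real_eq_top`).  Everything else in the printed proof is a theorem of the
tree: Thm. 6.7 from 6.1 (6.8–6.13, `thm67_weightOne_of_thm61_of_span`), Chebotarev over `ℚ`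
(`dirichletDensity_eq_holds`; Lemme 8.3, (6.12.1)), (2.7.2) from (C′) (Shimura (3.5.20),
Thm. 3.48 (2), 3.51, 3.52 and Deligne–Serre Rem. 2.8), Prop. 2.7, 5.1, 5.5, 7.2, Lemme 3.2 and
§8.2–8.6 (`thm41_exists_of_leaves`).
[cite: DeligneSerreASENS1974, Thm. 4.1; proof §8 with Thm. 6.1, Thm. 6.7, Prop. 2.7, Rem. 2.8] -/
theorem thm41_exists_of_thm61_of_periodLatticeK1_eq_span
    (h61 : ∀ (M : ℕ) [NeZero M] (k : ℤ), 2 ≤ k →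
      ∀ (g : CuspForm (Gamma1 M) k) (χ : DirichletCharacter ℂ M),
        g ∈ nebentypusSubspace M k χ → g ≠ 0 →
      ∀ (K : Type) [Field K] [NumberField K] (e : K →+* ℂ) (a : ℕ → K) (c : ZMod M → K),
        (∀ d, e (c d) = χ d) →
        (∀ (p : ℕ) (hp : p.Prime), ¬ p ∣ M →
          (haveI : NeZero p := ⟨hp.ne_zero⟩; heckeT (Gamma1 M) k p g) = e (a p) • g) →
      ∀ v : HeightOneSpectrum (𝓞 K),
        ∃ ρ : GaloisRepresentations.FramedGaloisRep ℚ (v.adicCompletion K) 2,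
          ρ.toGaloisRep.IsSemisimple ∧
          ∀ w : HeightOneSpectrum (𝓞 ℚ), ¬ ((primesEquiv w : Nat.Primes) : ℕ) ∣ M →
            (((primesEquiv w : Nat.Primes) : ℕ) : 𝓞 K) ∉ v.asIdeal →
            ρ.IsUnramifiedAt w ∧
            ρ.HasFrobCharpolyAt w
              ((X ^ 2 - C (a ((primesEquiv w : Nat.Primes) : ℕ)) * X +
                C (c ((primesEquiv w : Nat.Primes) : ℕ) *
                  (((primesEquiv w : Nat.Primes) : ℕ) : K) ^ (k - 1))).map
                (algebraMap K (v.adicCompletion K))))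
    (H : ∀ (M : ℕ) [NeZero M], ∃ n₀ : ℕ, ∀ n : ℕ, n₀ ≤ n →
      ∃ g : Fin (2 * Module.finrank ℂ (CuspForm (Gamma1 M) (n + 2))) →
          Module.Dual ℂ (CuspForm (Gamma1 M) (n + 2)),
        (periodLatticeK1 (N := M) n : Set (Module.Dual ℂ (CuspForm (Gamma1 M) (n + 2)))) =
          Submodule.span ℤ (Set.range g)) :
    thm41_exists (N := N) := by
  obtain ⟨n₀, hn₀⟩ := H N
  exact thm41_exists_of_thm67_of_periodLatticeK1_eq_span
    (thm67_weightOne_of_thm61_of_periodLatticeK1_eq_span h61 hn₀) H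

end Literature.NumberTheory.EllipticCurves.ModularForms.DeligneSerre1974
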